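import Literature.AlgebraicGeometry.KTheory.GrothendieckGroup
import Literature.AlgebraicGeometry.Motives.Varieties
import Mathlib.RingTheory.Ideal.Quotient.Operations
import Mathlib.AlgebraicGeometry.Morphisms.ClosedImmersion
import HarnessLib

/-!
# The `I`-adic thickening tower of an `O`-scheme and the pro-group `(lim_n K₀(X_n)) ⊗ ℚ`

Let `O` be a commutative ring, `I ⊆ O` an ideal and `X → Spec O` an `O`-scheme (intended case:
`O = W(k)` the Witt vectors of a perfect field of characteristic `p`, `I = (p)`, `X/W` smooth
projective, as in Bloch–Esnault–Kerz, *p-adic deformation of algebraic cycle classes*,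
Invent. math. 195 (2014), §1). We set up

* the thickenings `X_n = X ×_O Spec(O/I^{n+1})`, `n ≥ 0` (`thickening I X n`; so `X_0 = X ⊗ O/I`
  is the special fibre and, for `I = (p)`, `X_n` is Bloch–Esnault–Kerz's `X_{n+1} = X ⊗ W/p^{n+1}`),
  with the closed immersions `X_n ↪ X_{n+1}` (`thickeningTransition`) and `X_n ↪ X`
  (`thickeningι`), induced by `O/I^{n+2} → O/I^{n+1}` and `O → O/I^{n+1}`;
* the inverse limit `lim_n K₀(X_n)` of the Grothendieck groups of vector bundles along the
  pull-backs `K₀(X_{n+1}) → K₀(X_n)` (`LimKZero I X`, the group of compatible families), the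
  restriction `K₀(X) → lim_n K₀(X_n)` (`LimKZero.restrict`) and the projections
  (`LimKZero.proj`);
* **`ContinuousKZeroRat I X := (lim_n K₀(X_n)) ⊗_ℤ ℚ`**, the group in which Bloch–Esnault–Kerz's
  Theorem 1.3 (b) takes place ("there is `ξ̂ ∈ (lim_n K₀(X_n))_ℚ` such that
  `ξ̂|_{X_1} = ξ_1 ∈ K₀(X_1)_ℚ`"), with `ContinuousKZeroRat.restrict : K₀(X)_ℚ → (lim_n K₀(X_n))_ℚ`
  (the "algebraization" arrow `K₀(X) → lim_n K₀(X_n)` of BEK §1, tensored with `ℚ`), the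
  projections `ContinuousKZeroRat.proj n : (lim_n K₀(X_n))_ℚ → K₀(X_n)_ℚ`, in particular to the
  special fibre (`ContinuousKZeroRat.specialFibre = proj 0`, BEK's `ξ̂ ↦ ξ̂|_{X_1}`), and the
  compatibilities `proj_restrict`, `map_proj_succ`.

## Design choices

* `⊗ ℚ` is applied AFTER the inverse limit, as printed in BEK Thm 1.3 (`(lim_n K₀(X_n))_ℚ`, their
  convention "`- _ℚ = - ⊗_ℤ ℚ`"); this differs in general from `lim_n (K₀(X_n) ⊗ ℚ)`.
* This is NOT Bloch–Esnault–Kerz's continuous `K`-group `K₀^cont(X_•)` of their §9 ("Continuous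
  `K`-theory and Chern classes": `K^cont_i(X_•) = [S^i, K_{X_•}]` via Quillen's construction on the
  pro-system), which surjects onto `lim_n K₀(X_n)` with kernel `lim¹_n K₁(X_n)` (the short exact
  sequence displayed in BEK §9), nor `π₀` of Antieau–Mathew–Morrow–Nikolaus's spectrum
  `K^cts(X) := lim_n K(X/πⁿ)` (AMMN 2022, Question 1.4, "continuous `K`-theory"); the name
  `ContinuousKZeroRat` follows the requesting route and this usage. Only `lim_n K₀(X_n)`, the
  common target of those groups and the group of BEK Thm 1.3 (b), is defined here.
* The tower is indexed by an ideal `I` (take `I = Ideal.span {ϖ}` for a uniformizer `ϖ`, or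
  `Ideal.span {p}`); `X` is an object of the tree's `SchemeOver O = Over (Spec O)`
  (`Literature.AlgebraicGeometry.Motives.SchemeOver`), and the `X_n` are plain schemes with
  their structure maps `thickeningStructureMap n : X_n → Spec(O/I^{n+1})`; as `O/I^{n+1}`-schemes
  they are the tree's `baseChange O (O ⧸ I^{n+1})` of `X` (`thickeningOver`, definitionally).
  `X_n ↪ X` and `X_n ↪ X_{n+1}` are closed immersions (instances). Note `X_0 = X ⊗_O O/I^1`
  (Mathlib `Ideal.quotEquivOfEq (pow_one I) : O ⧸ I^1 ≃+* O ⧸ I` identifies it with `X ⊗_O O/I`).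
* The inverse limit is the concrete subgroup of compatible families in `Π_n K₀(X_n)`.
* Universe: `K₀` of a `Scheme.{u}` lives in `Type (u+1)` (`KTheory/GrothendieckGroup`), hence so
  do `LimKZero` and `ContinuousKZeroRat`.

## References

* S. Bloch, H. Esnault, M. Kerz, *p-adic deformation of algebraic cycle classes*, Invent. math.
  195 (2014) 673–722, §1 (Thm 1.3 and the diagram `K₀(X) → lim_n K₀(X_n) → K₀(X_1)`), §9.
  [BlochEsnaultKerz2014pAdic]
* B. Antieau, A. Mathew, M. Morrow, T. Nikolaus, *On the Beilinson fiber square*, Duke Math. J.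
  171 (2022), §1: Conj. 1.3 (p-adic variational Hodge conjecture), Question 1.4 (the p-adic
  deformation problem, `K^cts(X) := lim K(X/πⁿ)`). [AntieauMathewMorrowNikolaus2022]
* W. Fulton, *Intersection theory* (1998), §15.1 (`K⁰`, pull-back). [Fulton1998]
-/

universe u

open CategoryTheory Limits AlgebraicGeometry TensorProduct
open Literature.AlgebraicGeometry.Motives

noncomputable section

namespace Literature.AlgebraicGeometry.KTheory

variable {O : Type u} [CommRing O] (I : Ideal O) (X : SchemeOver O)

/-! ## The thickening tower `X_0 ↪ X_1 ↪ ⋯ ↪ X` -/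

/-- `I^{n+2} ≤ I^{n+1}`. [folklore] -/
theorem pow_succ_succ_le (n : ℕ) : I ^ (n + 1 + 1) ≤ I ^ (n + 1) :=
  Ideal.pow_le_pow_right (Nat.le_succ _)

/-- The closed immersion `Spec(O/I^{n+1}) → Spec O`. [folklore] -/
def truncSpecι (n : ℕ) : Spec (CommRingCat.of (O ⧸ I ^ (n + 1))) ⟶ Spec (CommRingCat.of O) :=
  Spec.map (CommRingCat.ofHom (Ideal.Quotient.mk (I ^ (n + 1))))

/-- The transition `Spec(O/I^{n+1}) → Spec(O/I^{n+2})`, from `O/I^{n+2} → O/I^{n+1}`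
(Mathlib `Ideal.Quotient.factor`). [folklore] -/
def truncSpecTransition (n : ℕ) :
    Spec (CommRingCat.of (O ⧸ I ^ (n + 1))) ⟶ Spec (CommRingCat.of (O ⧸ I ^ (n + 1 + 1))) :=
  Spec.map (CommRingCat.ofHom (Ideal.Quotient.factor (pow_succ_succ_le I n)))

/-- `Spec(O/I^{n+1}) → Spec(O/I^{n+2}) → Spec O` is `Spec(O/I^{n+1}) → Spec O`. [folklore] -/
@[reassoc (attr := simp)]
theorem truncSpecTransition_ι (n : ℕ) :
    truncSpecTransition I n ≫ truncSpecι I (n + 1) = truncSpecι I n := by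
  rw [truncSpecTransition, truncSpecι, truncSpecι, ← Spec.map_comp, ← CommRingCat.ofHom_comp,
    Ideal.Quotient.factor_comp_mk]

/-- **The `n`-th thickening `X_n = X ×_O Spec(O/I^{n+1})`** of the `O`-scheme `X` (`n ≥ 0`), the
closed subscheme of `X` cut out by `I^{n+1}𝒪_X`; `X_0` is the special fibre `X ⊗_O O/I`. For
`O = W(k)`, `I = (p)` this is Bloch–Esnault–Kerz's `X_{n+1} = X ⊗_W W/p^{n+1}` (BEK §1: "`X_n ↪ X`
the closed immersion defined by `(p^n)`; so `X_n = X ⊗_W W_n`, `W_n = W/(p^n)`").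
[cite: BlochEsnaultKerz2014pAdic, §1] -/
def thickening (n : ℕ) : Scheme.{u} :=
  pullback X.hom (truncSpecι I n)

/-- The closed immersion `X_n ↪ X` (first projection of `X ×_O Spec(O/I^{n+1})`). [folklore] -/
def thickeningι (n : ℕ) : thickening I X n ⟶ X.left :=
  pullback.fst X.hom (truncSpecι I n)

/-- The structure map `X_n → Spec(O/I^{n+1})` (second projection). [folklore] -/
def thickeningStructureMap (n : ℕ) : thickening I X n ⟶ Spec (CommRingCat.of (O ⧸ I ^ (n + 1))) :=
  pullback.snd X.hom (truncSpecι I n)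

/-- The cartesian square `X_n → Spec(O/I^{n+1})`, `X_n → X → Spec O` commutes. [folklore] -/
@[reassoc]
theorem thickeningι_hom (n : ℕ) :
    thickeningι I X n ≫ X.hom = thickeningStructureMap I X n ≫ truncSpecι I n :=
  pullback.condition

/-- `X_n` as an `O/I^{n+1}`-scheme: the tree's base change
`Literature.AlgebraicGeometry.Motives.baseChange O (O ⧸ I^{n+1})` applied to `X` (its underlying
scheme is `thickening I X n` and its structure map is `thickeningStructureMap I X n`, both
definitionally: `thickeningOver_left`, `thickeningOver_hom`). [folklore] -/
abbrev thickeningOver (n : ℕ) : SchemeOver (O ⧸ I ^ (n + 1)) :=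
  (baseChange O (O ⧸ I ^ (n + 1))).obj X

/-- The underlying scheme of `thickeningOver I X n` is `thickening I X n`. [folklore] -/
theorem thickeningOver_left (n : ℕ) : (thickeningOver I X n).left = thickening I X n := rfl

/-- The structure map of `thickeningOver I X n` is `thickeningStructureMap I X n`. [folklore] -/
theorem thickeningOver_hom (n : ℕ) : (thickeningOver I X n).hom = thickeningStructureMap I X n := rfl

/-- **The transition closed immersion `X_n ↪ X_{n+1}`**, induced by `O/I^{n+2} → O/I^{n+1}`
(universal property of `X_{n+1} = X ×_O Spec(O/I^{n+2})`). [folklore] -/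
def thickeningTransition (n : ℕ) : thickening I X n ⟶ thickening I X (n + 1) :=
  pullback.lift (thickeningι I X n) (thickeningStructureMap I X n ≫ truncSpecTransition I n)
    (by rw [thickeningι_hom, Category.assoc, truncSpecTransition_ι])

/-- `X_n ↪ X_{n+1} ↪ X` is `X_n ↪ X`. [folklore] -/
@[reassoc (attr := simp)]
theorem thickeningTransition_ι (n : ℕ) :
    thickeningTransition I X n ≫ thickeningι I X (n + 1) = thickeningι I X n :=
  pullback.lift_fst _ _ _

/-- `X_n ↪ X_{n+1} → Spec(O/I^{n+2})` is `X_n → Spec(O/I^{n+1}) → Spec(O/I^{n+2})`. [folklore] -/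
@[reassoc (attr := simp)]
theorem thickeningTransition_structureMap (n : ℕ) :
    thickeningTransition I X n ≫ thickeningStructureMap I X (n + 1) =
      thickeningStructureMap I X n ≫ truncSpecTransition I n :=
  pullback.lift_snd _ _ _

/-- `Spec(O/I^{n+1}) → Spec O` is a closed immersion (Mathlib
`IsClosedImmersion.spec_of_quotient_mk`). [folklore] -/
instance isClosedImmersion_truncSpecι (n : ℕ) : IsClosedImmersion (truncSpecι I n) := by
  unfold truncSpecι
  exact IsClosedImmersion.spec_of_surjective _ Ideal.Quotient.mk_surjective

/-- **`X_n ↪ X` is a closed immersion** (base change of `Spec(O/I^{n+1}) ↪ Spec O`). [folklore] -/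
instance isClosedImmersion_thickeningι (n : ℕ) : IsClosedImmersion (thickeningι I X n) := by
  unfold thickeningι thickening
  infer_instance

/-- **`X_n ↪ X_{n+1}` is a closed immersion** (`X_n ↪ X_{n+1} ↪ X` is the closed immersion
`X_n ↪ X`, and closed immersions cancel on the left, Mathlib
`IsClosedImmersion.of_comp_isClosedImmersion`). [folklore] -/
instance isClosedImmersion_thickeningTransition (n : ℕ) :
    IsClosedImmersion (thickeningTransition I X n) := by
  haveI : IsClosedImmersion (thickeningTransition I X n ≫ thickeningι I X (n + 1)) := by
    rw [thickeningTransition_ι]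
    infer_instance
  exact IsClosedImmersion.of_comp_isClosedImmersion _ (thickeningι I X (n + 1))

/-! ## The inverse limit `lim_n K₀(X_n)` -/

/-- **`lim_n K₀(X_n)`**: the inverse limit of the Grothendieck groups of vector bundles of the
thickenings along the pull-backs `K₀(X_{n+1}) → K₀(X_n)`, realised as the subgroup of compatible
families ("pro-`K₀` classes" `(ξ_n)_n`, `ξ_{n+1}|_{X_n} = ξ_n`) in `Π_n K₀(X_n)` (BEK §1, the middle
term of `K₀(X) → lim_n K₀(X_n) → K₀(X_1)`). [cite: BlochEsnaultKerz2014pAdic, §1 (Thm 1.3)] -/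
def LimKZero : AddSubgroup (∀ n : ℕ, KZero (thickening I X n)) where
  carrier := {x | ∀ n, KZero.map (thickeningTransition I X n) (x (n + 1)) = x n}
  zero_mem' n := by simp
  add_mem' {x y} hx hy n := by simp [hx n, hy n]
  neg_mem' {x} hx n := by simp [hx n]

/-- Membership in `lim_n K₀(X_n)`: compatibility with the transition pull-backs. [folklore] -/
theorem mem_limKZero_iff (x : ∀ n : ℕ, KZero (thickening I X n)) :
    x ∈ LimKZero I X ↔ ∀ n, KZero.map (thickeningTransition I X n) (x (n + 1)) = x n :=
  Iff.rfl

namespace LimKZero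

/-- The projection `lim_n K₀(X_n) → K₀(X_n)`. [folklore] -/
def proj (n : ℕ) : LimKZero I X →+ KZero (thickening I X n) :=
  (Pi.evalAddMonoidHom (fun m ↦ KZero (thickening I X m)) n).comp (LimKZero I X).subtype

/-- `proj n x = x n`. [folklore] -/
@[simp]
theorem proj_apply (n : ℕ) (x : LimKZero I X) : proj I X n x = (x : ∀ m, KZero (thickening I X m)) n :=
  rfl

/-- Compatibility of the projections with the transition pull-backs:
`(X_n ↪ X_{n+1})^* (x_{n+1}) = x_n`. [folklore] -/
@[simp]
theorem map_proj_succ (n : ℕ) (x : LimKZero I X) :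
    KZero.map (thickeningTransition I X n) (proj I X (n + 1) x) = proj I X n x :=
  x.2 n

/-- Two elements of `lim_n K₀(X_n)` with the same projections are equal. [folklore] -/
@[ext]
theorem ext {x y : LimKZero I X} (h : ∀ n, proj I X n x = proj I X n y) : x = y :=
  Subtype.ext (funext h)

/-- **The restriction `K₀(X) → lim_n K₀(X_n)`, `ξ ↦ (ξ|_{X_n})_n`** (the "algebraization" arrow
of BEK §1); the family is compatible by the functor law `(X_n ↪ X_{n+1} ↪ X)^* = (X_n ↪ X_{n+1})^*
∘ (X_{n+1} ↪ X)^*` (`KZero.map_comp`). [cite: BlochEsnaultKerz2014pAdic, §1] -/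
def restrict : KZero X.left →+ LimKZero I X :=
  (AddMonoidHom.pi fun n ↦ KZero.map (thickeningι I X n)).codRestrict (LimKZero I X) fun ξ n ↦ by
    change KZero.map (thickeningTransition I X n) (KZero.map (thickeningι I X (n + 1)) ξ) =
      KZero.map (thickeningι I X n) ξ
    rw [← KZero.map_comp_apply, thickeningTransition_ι]

/-- `(restrict ξ)_n = (X_n ↪ X)^* ξ`. [folklore] -/
@[simp]
theorem proj_restrict (n : ℕ) (ξ : KZero X.left) :
    proj I X n (restrict I X ξ) = KZero.map (thickeningι I X n) ξ :=
  rfl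

end LimKZero

/-! ## `(lim_n K₀(X_n)) ⊗ ℚ` -/

/-- **`ContinuousKZeroRat I X = (lim_n K₀(X_n)) ⊗_ℤ ℚ`**, the rationalised inverse limit of the
Grothendieck groups of vector bundles on the thickenings `X_n = X ×_O Spec(O/I^{n+1})`: the group
of Bloch–Esnault–Kerz's Theorem 1.3 (b) ("there is `ξ̂ ∈ (lim_n K₀(X_n))_ℚ` such that
`ξ̂|_{X_1} = ξ_1 ∈ K₀(X_1)_ℚ`"; `X/W` smooth projective, `W = W(k)`, `I = (p)`). Tensoring is
done AFTER the limit, as printed. Not BEK's `K₀^cont(X_•)` of their §9 (nor `π₀` of AMMN's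
`K^cts(X) = lim_n K(X/πⁿ)`, Question 1.4), both of which map onto `lim_n K₀(X_n)` with a `lim¹ K₁`
kernel. [cite: BlochEsnaultKerz2014pAdic, Thm 1.3] -/
abbrev ContinuousKZeroRat : Type (u + 1) := ℚ ⊗[ℤ] LimKZero I X

namespace ContinuousKZeroRat

/-- The canonical map `lim_n K₀(X_n) → (lim_n K₀(X_n))_ℚ`, `x ↦ 1 ⊗ x`. [folklore] -/
def ofLimKZero : LimKZero I X →+ ContinuousKZeroRat I X :=
  ((TensorProduct.mk ℤ ℚ (LimKZero I X)) 1).toAddMonoidHom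

/-- `ofLimKZero x = 1 ⊗ x`. [folklore] -/
@[simp] theorem ofLimKZero_apply (x : LimKZero I X) : ofLimKZero I X x = (1 : ℚ) ⊗ₜ[ℤ] x := rfl

/-- **The projection `(lim_n K₀(X_n))_ℚ → K₀(X_n)_ℚ`** (base change of `LimKZero.proj n`).
[folklore] -/
def proj (n : ℕ) : ContinuousKZeroRat I X →ₗ[ℚ] KZeroRat (thickening I X n) :=
  (LimKZero.proj I X n).toIntLinearMap.baseChange ℚ

/-- `proj n (a ⊗ x) = a ⊗ x_n`. [folklore] -/
@[simp]
theorem proj_tmul (n : ℕ) (a : ℚ) (x : LimKZero I X) :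
    proj I X n (a ⊗ₜ[ℤ] x) = a ⊗ₜ[ℤ] LimKZero.proj I X n x :=
  rfl

/-- **Restriction to the special fibre `(lim_n K₀(X_n))_ℚ → K₀(X_0)_ℚ`**, `ξ̂ ↦ ξ̂|_{X_0}` (BEK's
`ξ̂|_{X_1}` in their numbering `X_1 =` closed fibre; Thm 1.3 (b)). [cite: BlochEsnaultKerz2014pAdic, Thm 1.3] -/
abbrev specialFibre : ContinuousKZeroRat I X →ₗ[ℚ] KZeroRat (thickening I X 0) := proj I X 0

/-- **The restriction `K₀(X)_ℚ → (lim_n K₀(X_n))_ℚ`, `ξ ↦ (ξ|_{X_n})_n ⊗ ℚ`** (BEK §1, the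
algebraization arrow, rationalised; base change of `LimKZero.restrict`).
[cite: BlochEsnaultKerz2014pAdic, §1] -/
def restrict : KZeroRat X.left →ₗ[ℚ] ContinuousKZeroRat I X :=
  (LimKZero.restrict I X).toIntLinearMap.baseChange ℚ

/-- `restrict (a ⊗ ξ) = a ⊗ (ξ|_{X_n})_n`. [folklore] -/
@[simp]
theorem restrict_tmul (a : ℚ) (ξ : KZero X.left) :
    restrict I X (a ⊗ₜ[ℤ] ξ) = a ⊗ₜ[ℤ] LimKZero.restrict I X ξ :=
  rfl

/-- **Compatibility of the projections**: `(X_n ↪ X_{n+1})^* (proj (n+1) ξ̂) = proj n ξ̂` on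
`(lim_n K₀(X_n))_ℚ`. [folklore] -/
@[simp]
theorem map_proj_succ (n : ℕ) (ξ : ContinuousKZeroRat I X) :
    KZeroRat.map (thickeningTransition I X n) (proj I X (n + 1) ξ) = proj I X n ξ := by
  induction ξ using TensorProduct.induction_on with
  | zero => simp
  | tmul a x => rw [proj_tmul, proj_tmul, KZeroRat.map_tmul, LimKZero.map_proj_succ]
  | add ξ η hξ hη => rw [map_add, map_add, hξ, hη, map_add]

/-- **`proj n ∘ restrict = (X_n ↪ X)^*`**: restricting `ξ ∈ K₀(X)_ℚ` to the tower and projecting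
to `X_n` is pulling back along `X_n ↪ X`; for `n = 0` this is `ξ ↦ ξ|_{X_0}` to the special
fibre, the composite `K₀(X) → lim_n K₀(X_n) → K₀(X_1)` of BEK §1. [folklore] -/
@[simp]
theorem proj_restrict (n : ℕ) (ξ : KZeroRat X.left) :
    proj I X n (restrict I X ξ) = KZeroRat.map (thickeningι I X n) ξ := by
  induction ξ using TensorProduct.induction_on with
  | zero => simp
  | tmul a x => rw [restrict_tmul, proj_tmul, KZeroRat.map_tmul, LimKZero.proj_restrict]
  | add ξ η hξ hη => rw [map_add, map_add, hξ, hη, map_add]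

/-- On the class of a vector bundle `E` on `X`: `proj n (restrict [E]_ℚ) = [E|_{X_n}]_ℚ`.
[folklore] -/
theorem proj_restrict_of (n : ℕ) (E : X.left.Modules) (hE : IsFiniteLocallyFree E) :
    proj I X n (restrict I X (KZeroRat.of E hE)) =
      KZeroRat.of ((Scheme.Modules.pullback (thickeningι I X n)).obj E)
        (hE.pullback (thickeningι I X n)) := by
  rw [proj_restrict, KZeroRat.map_of]

end ContinuousKZeroRat

end Literature.AlgebraicGeometry.KTheory

end
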